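import Summits.CriticalPhenomena.PercolationContinuityZ3.Theses.PercAntiMeanFieldOnset
import Literature.Probability.Percolation.Percolation
import HarnessLib

/-!
# Coupling toolkit for `PercAntiMeanFieldOnset.OnsetIncrementBound` (stmt-CriticalPhenomena-5108):
# a jump of `{0 ↔ ∞}` between two coupled configurations uses a new edge on the boundary of the old cluster

RSW3 lane (cell `prim-rsw3`, prover P2, gen 31).  Helper (`--supports stmt-CriticalPhenomena-5108`): if
the cluster of `o` is finite in `ω` and infinite in `ω'` (no inclusion needed), then some pair `s(a,b) ∈ ω' \ ω` has
`a` in the `ω`-cluster of `o` and `b` outside it (the first edge by which an `ω'`-open path from `o` leaves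
the finite `ω`-cluster).  In the monotone coupling (`ω = η_p ⊆ η_q = ω'`) this is the edge with label in
`(p, q]` of Russo's inequality.  Nothing here uses p205010.
-/

namespace Summit.CriticalPhenomena.PercolationContinuityZ3.Theorems.Coupling

open Literature.Probability.Percolation

variable {V : Type*}

/-- **Exit edge of a jump.**  If `C_ω(o)` is finite and `C_{ω'}(o)` is infinite (e.g. `ω ⊆ ω'`), then there are
`a ∈ C_ω(o)`, `b ∉ C_ω(o)` with `s(a,b) ∈ ω' \ ω`. -/
theorem exists_exit_pair_of_jump {ω ω' : BondConfig V} {o : V}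
    (hfin : (openCluster ω o).Finite) (hinf : (openCluster ω' o).Infinite) :
    ∃ a b : V, a ∈ openCluster ω o ∧ b ∉ openCluster ω o ∧ s(a, b) ∈ ω' ∧ s(a, b) ∉ ω := by
  classical
  -- a vertex of the new cluster outside the old one
  obtain ⟨z, hz', hz⟩ : ∃ z, z ∈ openCluster ω' o ∧ z ∉ openCluster ω o := by
    by_contra h
    push Not at h
    exact hinf (hfin.subset fun z hz => h z hz)
  -- an `ω'`-open walk from `o` to `z` leaves `C_ω(o)` through a dart `(a, b)`
  obtain ⟨W⟩ := (hz' : (openGraph ω').Reachable o z)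
  obtain ⟨d, -, hdC, hdC'⟩ := W.exists_boundary_dart (openCluster ω o) (mem_openCluster_self ω o) hz
  have hadj : (openGraph ω').Adj d.fst d.snd := d.adj
  rw [openGraph_adj] at hadj
  refine ⟨d.fst, d.snd, hdC, hdC', hadj.1, fun hmem => hdC' ?_⟩
  -- if the pair were `ω`-open, `b` would belong to `C_ω(o)`
  have hadjω : (openGraph ω).Adj d.fst d.snd := (openGraph_adj ω _ _).2 ⟨hmem, hadj.2⟩
  exact SimpleGraph.Reachable.trans hdC hadjω.reachable

/-- **Exit edge of a jump, monotone-coupling form.**  For labels `U` and levels `p, q`: if `o` percolates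
in `η_q = configOfLabels q U G` but not in `η_p`, then some lattice edge `s(a,b)` with `a ∈ C_{η_p}(0)`,
`b ∉ C_{η_p}(0)` has label `U_{ab} ∈ (p, q]`. -/
theorem exists_exit_label_of_jump (G : SimpleGraph V) (U : Sym2 V → ℝ) {p q : ℝ} {o : V}
    (hp : configOfLabels p U G ∉ percolatesAt o) (hq : configOfLabels q U G ∈ percolatesAt o) :
    ∃ a b : V, a ∈ openCluster (configOfLabels p U G) o ∧ b ∉ openCluster (configOfLabels p U G) o ∧
      s(a, b) ∈ G.edgeSet ∧ p < U s(a, b) ∧ U s(a, b) ≤ q := by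
  have hfin : (openCluster (configOfLabels p U G) o).Finite := Set.not_infinite.1 hp
  obtain ⟨a, b, ha, hb, hq', hp'⟩ := exists_exit_pair_of_jump hfin hq
  refine ⟨a, b, ha, hb, hq'.1, ?_, hq'.2⟩
  by_contra hle
  exact hp' ⟨hq'.1, not_lt.1 hle⟩

end Summit.CriticalPhenomena.PercolationContinuityZ3.Theorems.Coupling
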